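import Mathlib
import Literature.NumberTheory.Transcendental.GammaFields
import Literature.NumberTheory.Transcendental.GammaIsoAlgebraicStep
import Summits.Schanuel.Schanuel.Theorems.RigidCoreAclSubsetLogFreeCoreCaseIIReduceChains

/-!
# Case II reduction, file 2: the E/L/A-chain spaces exhaust the ELA-core
(helper file for the registered stub `stub_caseII_reduce` of line `eac-extends-core-automorphisms`,
crux stmt-Schanuel-0968 `Summit.Schanuel.Schanuel.Theses.RigidCore.AclSubsetLogFreeCore`)

For a `ℚ`-subspace `Λ` of an exponential field `F` of characteristic `0`, the union `S` of the
relative algebraic closures `acl (gens W)` of the Γ-fields of all E/L/A-chain spaces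
`W = Λ + ℚ(range u)` over `Λ` (chains as in file 1: each entry an A-step or an L-step over the space
reached so far) is the carrier of an intermediate field `ℚ ≤ K ≤ F` containing `Λ`, closed under
`exp`, under logarithms, and relatively algebraically closed in `F` (`exists_chainField`): chains
concatenate (`chain_append`), an element algebraic over `ℚ(gens W)` or a logarithm of such is one
more step (`chain_snoc`), and relative algebraic closure is finitary
(`Matroid.exists_mem_finite_closure_of_mem_closure`). Consequently every element of the ELA-core
over `τ` — the intersection of all intermediate fields containing `τ` with these three closure
properties — lies in the span of an E/L/A-chain over `ℚτ` (`exists_chain_of_mem_sInf`).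

Also: Fin-bookkeeping for prefixes of `Fin.snoc`/`Fin.append` tuples (`image_snoc_Iio_castSucc`,
`image_append_Iio_natAdd`, …), used again by the deformation file.
-/

noncomputable section

-- the namespace `Summit.Schanuel.Schanuel.…` (problem = summit, D-0022) trips the duplicated-namespace
-- linter on every declaration; the project lakefile disables it for the same reason.
set_option linter.dupNamespace false

open Set
open Literature.ModelTheory.ExponentialFields Literature.ModelTheory.ExponentialFields.ExponentialRing
open Literature.NumberTheory.Transcendental Literature.NumberTheory.Transcendental.GammaField

namespace Summit.Schanuel.Schanuel.Theorems.RigidCore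

namespace CaseIIReduce

variable {F : Type} [Field F] [CharZero F] [ExponentialRing F]

/-! ### Prefixes of `Fin.snoc` and `Fin.append` tuples -/

omit [Field F] [CharZero F] [ExponentialRing F] in
/-- Prefixes of `Fin.snoc u x` below an old index are prefixes of `u`. [folklore] -/
theorem image_snoc_Iio_castSucc {n : ℕ} (u : Fin n → F) (x : F) (j : Fin n) :
    (Fin.snoc u x : Fin (n + 1) → F) '' Set.Iio (Fin.castSucc j) = u '' Set.Iio j := by
  ext y
  constructor
  · rintro ⟨k, hk, rfl⟩
    have hkj : (k : ℕ) < j := hk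
    have hkn : (k : ℕ) < n := lt_trans hkj j.isLt
    refine ⟨⟨k, hkn⟩, hkj, ?_⟩
    have hk' : k = Fin.castSucc ⟨k, hkn⟩ := Fin.ext rfl
    have h := Fin.snoc_castSucc (α := fun _ => F) x u ⟨k, hkn⟩
    rw [← hk'] at h
    exact h.symm
  · rintro ⟨k, hk, rfl⟩
    exact ⟨Fin.castSucc k, Fin.castSucc_lt_castSucc_iff.2 hk, Fin.snoc_castSucc ..⟩

omit [Field F] [CharZero F] [ExponentialRing F] in
/-- The prefix of `Fin.snoc u x` below the last index is `range u`. [folklore] -/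
theorem image_snoc_Iio_last {n : ℕ} (u : Fin n → F) (x : F) :
    (Fin.snoc u x : Fin (n + 1) → F) '' Set.Iio (Fin.last n) = range u := by
  ext y
  constructor
  · rintro ⟨k, hk, rfl⟩
    have hkn : (k : ℕ) < n := hk
    refine ⟨⟨k, hkn⟩, ?_⟩
    have hk' : k = Fin.castSucc ⟨k, hkn⟩ := Fin.ext rfl
    have h := Fin.snoc_castSucc (α := fun _ => F) x u ⟨k, hkn⟩
    rw [← hk'] at h
    exact h.symm
  · rintro ⟨k, rfl⟩
    exact ⟨Fin.castSucc k, Fin.castSucc_lt_last k, Fin.snoc_castSucc ..⟩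

omit [Field F] [CharZero F] [ExponentialRing F] in
/-- Prefixes of `Fin.append u u'` below a left index are prefixes of `u`. [folklore] -/
theorem image_append_Iio_castAdd {n m : ℕ} (u : Fin n → F) (u' : Fin m → F) (j : Fin n) :
    Fin.append u u' '' Set.Iio (Fin.castAdd m j) = u '' Set.Iio j := by
  ext y
  constructor
  · rintro ⟨k, hk, rfl⟩
    have hkj : (k : ℕ) < j := hk
    have hkn : (k : ℕ) < n := lt_trans hkj j.isLt
    refine ⟨⟨k, hkn⟩, hkj, ?_⟩
    have hk' : k = Fin.castAdd m ⟨k, hkn⟩ := Fin.ext rfl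
    have h := Fin.append_left u u' ⟨k, hkn⟩
    rw [← hk'] at h
    exact h.symm
  · rintro ⟨k, hk, rfl⟩
    refine ⟨Fin.castAdd m k, ?_, Fin.append_left ..⟩
    show (k : ℕ) < j
    exact hk

omit [Field F] [CharZero F] [ExponentialRing F] in
/-- Prefixes of `Fin.append u u'` below a right index: all of `u` and a prefix of `u'`. [folklore] -/
theorem image_append_Iio_natAdd {n m : ℕ} (u : Fin n → F) (u' : Fin m → F) (j : Fin m) :
    Fin.append u u' '' Set.Iio (Fin.natAdd n j) = range u ∪ u' '' Set.Iio j := by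
  ext y
  constructor
  · rintro ⟨k, hk, rfl⟩
    have hkj : (k : ℕ) < n + j := hk
    by_cases hkn : (k : ℕ) < n
    · left
      refine ⟨⟨k, hkn⟩, ?_⟩
      have hk' : k = Fin.castAdd m ⟨k, hkn⟩ := Fin.ext rfl
      have h := Fin.append_left u u' ⟨k, hkn⟩
      rw [← hk'] at h
      exact h.symm
    · right
      have hkm : (k : ℕ) - n < m := by omega
      refine ⟨⟨k - n, hkm⟩, ?_, ?_⟩
      · show (k : ℕ) - n < j
        omega
      · have hk' : k = Fin.natAdd n ⟨k - n, hkm⟩ := Fin.ext (by simp; omega)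
        have h := Fin.append_right u u' ⟨k - n, hkm⟩
        rw [← hk'] at h
        exact h.symm
  · rintro (⟨k, rfl⟩ | ⟨k, hk, rfl⟩)
    · refine ⟨Fin.castAdd m k, ?_, Fin.append_left ..⟩
      show (k : ℕ) < n + j
      omega
    · refine ⟨Fin.natAdd n k, ?_, Fin.append_right ..⟩
      show n + (k : ℕ) < n + j
      have : (k : ℕ) < j := hk
      omega

omit [ExponentialRing F] in
/-- The space of `Fin.snoc u x`. [folklore] -/
theorem sup_span_range_snoc (Λ : Submodule ℚ F) {n : ℕ} (u : Fin n → F) (x : F) :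
    Λ ⊔ Submodule.span ℚ (range (Fin.snoc u x : Fin (n + 1) → F)) =
      (Λ ⊔ Submodule.span ℚ (range u)) ⊔ Submodule.span ℚ {x} := by
  rw [Fin.range_snoc, Submodule.span_insert, sup_assoc, sup_comm (Submodule.span ℚ {x})]

omit [ExponentialRing F] in
/-- The space of `Fin.append u u'`. [folklore] -/
theorem sup_span_range_append (Λ : Submodule ℚ F) {n m : ℕ} (u : Fin n → F) (u' : Fin m → F) :
    Λ ⊔ Submodule.span ℚ (range (Fin.append u u')) =
      (Λ ⊔ Submodule.span ℚ (range u)) ⊔ Submodule.span ℚ (range u') := by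
  rw [ZilberHomogeneity.range_append, Submodule.span_union, sup_assoc]

/-! ### Building chains: one more step, concatenation, change of base -/

/-- **One more step.** Appending to a chain over `Λ` an element which is an A-step or an L-step over
the chain space gives a chain over `Λ`. [folklore] -/
theorem chain_snoc {Λ : Submodule ℚ F} {n : ℕ} (u : Fin n → F)
    (hu : ∀ i : Fin n, u i ∈ acl (gens (Λ ⊔ Submodule.span ℚ (u '' Set.Iio i))) ∨
      exp (u i) ∈ acl (gens (Λ ⊔ Submodule.span ℚ (u '' Set.Iio i)))) {x : F}
    (hx : x ∈ acl (gens (Λ ⊔ Submodule.span ℚ (range u))) ∨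
      exp x ∈ acl (gens (Λ ⊔ Submodule.span ℚ (range u)))) :
    ∀ i : Fin (n + 1), (Fin.snoc u x : Fin (n + 1) → F) i ∈
        acl (gens (Λ ⊔ Submodule.span ℚ ((Fin.snoc u x : Fin (n + 1) → F) '' Set.Iio i))) ∨
      exp ((Fin.snoc u x : Fin (n + 1) → F) i) ∈
        acl (gens (Λ ⊔ Submodule.span ℚ ((Fin.snoc u x : Fin (n + 1) → F) '' Set.Iio i))) := by
  intro i
  refine Fin.lastCases ?_ (fun j => ?_) i
  · rw [Fin.snoc_last, image_snoc_Iio_last]; exact hx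
  · rw [Fin.snoc_castSucc, image_snoc_Iio_castSucc]; exact hu j

/-- **Concatenation.** A chain `u` over `Λ` followed by a chain `u'` over the chain space
`Λ + ℚ(range u)` is a chain over `Λ`. [folklore] -/
theorem chain_append {Λ : Submodule ℚ F} {n m : ℕ} (u : Fin n → F) (u' : Fin m → F)
    (hu : ∀ i : Fin n, u i ∈ acl (gens (Λ ⊔ Submodule.span ℚ (u '' Set.Iio i))) ∨
      exp (u i) ∈ acl (gens (Λ ⊔ Submodule.span ℚ (u '' Set.Iio i))))
    (hu' : ∀ j : Fin m, u' j ∈ acl (gens ((Λ ⊔ Submodule.span ℚ (range u)) ⊔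
        Submodule.span ℚ (u' '' Set.Iio j))) ∨
      exp (u' j) ∈ acl (gens ((Λ ⊔ Submodule.span ℚ (range u)) ⊔
        Submodule.span ℚ (u' '' Set.Iio j)))) :
    ∀ i : Fin (n + m), Fin.append u u' i ∈
        acl (gens (Λ ⊔ Submodule.span ℚ (Fin.append u u' '' Set.Iio i))) ∨
      exp (Fin.append u u' i) ∈
        acl (gens (Λ ⊔ Submodule.span ℚ (Fin.append u u' '' Set.Iio i))) := by
  intro i
  refine Fin.addCases (fun j => ?_) (fun j => ?_) i
  · rw [Fin.append_left, image_append_Iio_castAdd]; exact hu j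
  · rw [Fin.append_right, image_append_Iio_natAdd, Submodule.span_union, ← sup_assoc]; exact hu' j

/-- **Change of base.** A chain over `Λ` is a chain over any `W ⊇ Λ`. [folklore] -/
theorem chain_mono {Λ W : Submodule ℚ F} (hΛW : Λ ≤ W) {n : ℕ} (u : Fin n → F)
    (hu : ∀ i : Fin n, u i ∈ acl (gens (Λ ⊔ Submodule.span ℚ (u '' Set.Iio i))) ∨
      exp (u i) ∈ acl (gens (Λ ⊔ Submodule.span ℚ (u '' Set.Iio i)))) :
    ∀ i : Fin n, u i ∈ acl (gens (W ⊔ Submodule.span ℚ (u '' Set.Iio i))) ∨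
      exp (u i) ∈ acl (gens (W ⊔ Submodule.span ℚ (u '' Set.Iio i))) := fun i =>
  (hu i).imp (fun h => acl_mono (gens_mono (sup_le_sup_right hΛW _)) h)
    (fun h => acl_mono (gens_mono (sup_le_sup_right hΛW _)) h)

/-- **Chain spaces over `Λ` are directed**: two chain spaces lie in a third. [folklore] -/
theorem exists_chain_ge_two (Λ : Submodule ℚ F) {n m : ℕ} (u : Fin n → F) (u' : Fin m → F)
    (hu : ∀ i : Fin n, u i ∈ acl (gens (Λ ⊔ Submodule.span ℚ (u '' Set.Iio i))) ∨
      exp (u i) ∈ acl (gens (Λ ⊔ Submodule.span ℚ (u '' Set.Iio i))))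
    (hu' : ∀ j : Fin m, u' j ∈ acl (gens (Λ ⊔ Submodule.span ℚ (u' '' Set.Iio j))) ∨
      exp (u' j) ∈ acl (gens (Λ ⊔ Submodule.span ℚ (u' '' Set.Iio j)))) :
    ∃ (k : ℕ) (w : Fin k → F),
      (∀ i : Fin k, w i ∈ acl (gens (Λ ⊔ Submodule.span ℚ (w '' Set.Iio i))) ∨
        exp (w i) ∈ acl (gens (Λ ⊔ Submodule.span ℚ (w '' Set.Iio i)))) ∧
      Λ ⊔ Submodule.span ℚ (range u) ≤ Λ ⊔ Submodule.span ℚ (range w) ∧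
      Λ ⊔ Submodule.span ℚ (range u') ≤ Λ ⊔ Submodule.span ℚ (range w) := by
  refine ⟨n + m, Fin.append u u', chain_append u u' hu (chain_mono le_sup_left u' hu'), ?_, ?_⟩
  · rw [sup_span_range_append]; exact le_sup_left
  · rw [sup_span_range_append]; exact sup_le (le_sup_left.trans le_sup_left) le_sup_right

/-- **Finitely many elements of the union lie in one member**: if every element of a finite set
`I` is algebraic over the Γ-field of some chain space over `Λ`, then all of `I` is algebraic over the
Γ-field of a single chain space. [folklore] -/
theorem exists_chain_of_finite (Λ : Submodule ℚ F) {I : Set F} (hI : I.Finite)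
    (h : ∀ x ∈ I, ∃ (n : ℕ) (u : Fin n → F),
      (∀ i : Fin n, u i ∈ acl (gens (Λ ⊔ Submodule.span ℚ (u '' Set.Iio i))) ∨
        exp (u i) ∈ acl (gens (Λ ⊔ Submodule.span ℚ (u '' Set.Iio i)))) ∧
      x ∈ acl (gens (Λ ⊔ Submodule.span ℚ (range u)))) :
    ∃ (n : ℕ) (u : Fin n → F),
      (∀ i : Fin n, u i ∈ acl (gens (Λ ⊔ Submodule.span ℚ (u '' Set.Iio i))) ∨
        exp (u i) ∈ acl (gens (Λ ⊔ Submodule.span ℚ (u '' Set.Iio i)))) ∧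
      I ⊆ acl (gens (Λ ⊔ Submodule.span ℚ (range u))) := by
  induction I, hI using Set.Finite.induction_on with
  | empty => exact ⟨0, Fin.elim0, fun i => i.elim0, empty_subset _⟩
  | @insert x J hxJ hJ ih =>
    obtain ⟨n, u, hu, hJu⟩ := ih (fun y hy => h y (mem_insert_of_mem _ hy))
    obtain ⟨m, u', hu', hxu'⟩ := h x (mem_insert _ _)
    obtain ⟨k, w, hw, h1, h2⟩ := exists_chain_ge_two Λ u u' hu hu'
    refine ⟨k, w, hw, insert_subset (acl_mono (gens_mono h2) hxu') ?_⟩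
    exact hJu.trans (acl_mono (gens_mono h1))

/-! ### The union of the `acl (gens W)` over chain spaces `W` is an ELA-closed intermediate field -/

/-- **The chain field.** There is an intermediate field `ℚ ≤ K ≤ F` whose elements are exactly the
elements algebraic over the Γ-field `ℚ(gens W)` of some E/L/A-chain space `W` over `Λ`; it contains
`Λ`, is closed under `exp`, under logarithms (`exp w ∈ K ⟹ w ∈ K`) and is relatively algebraically
closed in `F`. [folklore] -/
theorem exists_chainField (Λ : Submodule ℚ F) :
    ∃ K : IntermediateField ℚ F,
      (∀ x : F, x ∈ K ↔ ∃ (n : ℕ) (u : Fin n → F),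
        (∀ i : Fin n, u i ∈ acl (gens (Λ ⊔ Submodule.span ℚ (u '' Set.Iio i))) ∨
          exp (u i) ∈ acl (gens (Λ ⊔ Submodule.span ℚ (u '' Set.Iio i)))) ∧
        x ∈ acl (gens (Λ ⊔ Submodule.span ℚ (range u)))) ∧
      Λ ≤ Subalgebra.toSubmodule K.toSubalgebra ∧
      (∀ w ∈ K, exp w ∈ K) ∧ (∀ w : F, IsAlgebraic K w → w ∈ K) ∧ (∀ w : F, exp w ∈ K → w ∈ K) := by
  classical
  -- the carrier
  set S : Set F := {x | ∃ (n : ℕ) (u : Fin n → F),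
      (∀ i : Fin n, u i ∈ acl (gens (Λ ⊔ Submodule.span ℚ (u '' Set.Iio i))) ∨
        exp (u i) ∈ acl (gens (Λ ⊔ Submodule.span ℚ (u '' Set.Iio i)))) ∧
      x ∈ acl (gens (Λ ⊔ Submodule.span ℚ (range u)))} with hSdef
  -- the empty chain: `acl (gens Λ) ⊆ S`
  have h0 : ∀ x ∈ acl (gens Λ), x ∈ S := fun x hx =>
    ⟨0, Fin.elim0, fun i => i.elim0, acl_mono (gens_mono le_sup_left) hx⟩
  -- two elements of `S` lie in one `acl (gens W)`
  have h2 : ∀ x ∈ S, ∀ y ∈ S, ∃ (n : ℕ) (u : Fin n → F),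
      (∀ i : Fin n, u i ∈ acl (gens (Λ ⊔ Submodule.span ℚ (u '' Set.Iio i))) ∨
        exp (u i) ∈ acl (gens (Λ ⊔ Submodule.span ℚ (u '' Set.Iio i)))) ∧
      x ∈ acl (gens (Λ ⊔ Submodule.span ℚ (range u))) ∧
      y ∈ acl (gens (Λ ⊔ Submodule.span ℚ (range u))) := by
    intro x hx y hy
    have hfin : ({x, y} : Set F).Finite := (finite_singleton y).insert x
    obtain ⟨n, u, hu, hsub⟩ := exists_chain_of_finite Λ hfin (by
      rintro z (rfl | rfl)
      · exact hx
      · exact hy)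
    exact ⟨n, u, hu, hsub (mem_insert _ _), hsub (mem_insert_of_mem _ (mem_singleton _))⟩
  let K : IntermediateField ℚ F :=
    { carrier := S
      mul_mem' := fun {x y} hx hy => by
        obtain ⟨n, u, hu, hxu, hyu⟩ := h2 x hx y hy
        exact ⟨n, u, hu, mul_mem_acl hxu hyu⟩
      one_mem' := h0 1 (one_mem_acl _)
      add_mem' := fun {x y} hx hy => by
        obtain ⟨n, u, hu, hxu, hyu⟩ := h2 x hx y hy
        exact ⟨n, u, hu, add_mem_acl hxu hyu⟩
      zero_mem' := h0 0 (zero_mem_acl _)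
      algebraMap_mem' := fun q => h0 _ (algebraMap_mem_acl q)
      inv_mem' := fun x hx => by
        obtain ⟨n, u, hu, hxu⟩ := hx
        exact ⟨n, u, hu, inv_mem_acl hxu⟩ }
  have hmemK : ∀ x : F, x ∈ K ↔ x ∈ S := fun x => Iff.rfl
  refine ⟨K, fun x => hmemK x, ?_, ?_, ?_, ?_⟩
  · -- `Λ ≤ K`
    intro x hx
    exact h0 x (subset_acl _ (mem_gens_of_mem hx))
  · -- closed under `exp`: an element of `acl (gens W)` is an A-step over `W`
    intro w hw
    obtain ⟨n, u, hu, hwu⟩ := (hmemK w).1 hw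
    refine (hmemK _).2 ⟨n + 1, Fin.snoc u w, chain_snoc u hu (Or.inl hwu), ?_⟩
    rw [sup_span_range_snoc]
    exact subset_acl _ (exp_mem_gens (Submodule.mem_sup_right (Submodule.mem_span_singleton_self w)))
  · -- relatively algebraically closed: finitary closure
    intro w hw
    have hw' : w ∈ acl (S : Set F) := mem_acl_coe_of_isAlgebraic K hw
    obtain ⟨I, hIS, hIfin, -, hwI⟩ :=
      Matroid.exists_mem_finite_closure_of_mem_closure (M := algMatroid F) (X := S) (e := w) hw'
    obtain ⟨n, u, hu, hIu⟩ := exists_chain_of_finite Λ hIfin (fun x hx => hIS hx)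
    exact (hmemK w).2 ⟨n, u, hu, acl_subset_acl_of_subset hIu hwI⟩
  · -- closed under logarithms: an element whose `exp` lies in `acl (gens W)` is an L-step over `W`
    intro w hw
    obtain ⟨n, u, hu, hwu⟩ := (hmemK _).1 hw
    refine (hmemK _).2 ⟨n + 1, Fin.snoc u w, chain_snoc u hu (Or.inr hwu), ?_⟩
    rw [sup_span_range_snoc]
    exact subset_acl _ (mem_gens_of_mem (Submodule.mem_sup_right (Submodule.mem_span_singleton_self w)))

/-- **Elements of the ELA-core lie in chain spaces.** If `a` belongs to every intermediate field
`ℚ ≤ K ≤ F` which contains `τ`, is closed under `exp`, relatively algebraically closed in `F` and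
closed under logarithms, then `a` lies in the span of an E/L/A-chain over `ℚτ`. [folklore] -/
theorem exists_chain_of_mem_sInf {τ a : F}
    (ha : a ∈ (sInf {K : IntermediateField ℚ F | τ ∈ K ∧ (∀ w ∈ K, exp w ∈ K) ∧
      (∀ w : F, IsAlgebraic K w → w ∈ K) ∧ (∀ w : F, exp w ∈ K → w ∈ K)} :
        IntermediateField ℚ F)) :
    ∃ (n : ℕ) (u : Fin n → F),
      (∀ i : Fin n, u i ∈ acl (gens (Submodule.span ℚ {τ} ⊔ Submodule.span ℚ (u '' Set.Iio i))) ∨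
        exp (u i) ∈ acl (gens (Submodule.span ℚ {τ} ⊔ Submodule.span ℚ (u '' Set.Iio i)))) ∧
      a ∈ Submodule.span ℚ {τ} ⊔ Submodule.span ℚ (range u) := by
  obtain ⟨K, hK, hΛK, hexpK, halgK, hlogK⟩ := exists_chainField (Submodule.span ℚ ({τ} : Set F))
  have hKmem : K ∈ {K : IntermediateField ℚ F | τ ∈ K ∧ (∀ w ∈ K, exp w ∈ K) ∧
      (∀ w : F, IsAlgebraic K w → w ∈ K) ∧ (∀ w : F, exp w ∈ K → w ∈ K)} :=
    ⟨hΛK (Submodule.mem_span_singleton_self τ), hexpK, halgK, hlogK⟩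
  have haK : a ∈ K := (IntermediateField.mem_sInf.1 ha) K hKmem
  obtain ⟨n, u, hu, hau⟩ := (hK a).1 haK
  refine ⟨n + 1, Fin.snoc u a, chain_snoc u hu (Or.inl hau), ?_⟩
  rw [sup_span_range_snoc]
  exact Submodule.mem_sup_right (Submodule.mem_span_singleton_self a)

/-! ### A-chain spaces lie in every `exp`-closed relatively algebraically closed field over the base -/

/-- **A-chains stay inside EA-closed fields.** If every entry of `u` is an A-step over the space
reached so far (a chain without L-steps) and `K` is an intermediate field containing `Λ`, closed
under `exp` and relatively algebraically closed in `F`, then the chain space `Λ + ℚ(range u)` lies in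
`K`: `gens P ⊆ K` for `P ≤ K`, hence `acl (gens P) ⊆ K`. [folklore] -/
theorem sup_span_range_le_of_Achain {Λ : Submodule ℚ F} {n : ℕ} (u : Fin n → F)
    (hu : ∀ i : Fin n, u i ∈ acl (gens (Λ ⊔ Submodule.span ℚ (u '' Set.Iio i))))
    (K : IntermediateField ℚ F) (hΛK : Λ ≤ Subalgebra.toSubmodule K.toSubalgebra)
    (hKexp : ∀ w ∈ K, exp w ∈ K) (hKalg : ∀ w : F, IsAlgebraic K w → w ∈ K) :
    Λ ⊔ Submodule.span ℚ (range u) ≤ Subalgebra.toSubmodule K.toSubalgebra := by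
  -- `acl (gens P) ⊆ K` whenever `P ≤ K`
  have haclK : ∀ P : Submodule ℚ F, P ≤ Subalgebra.toSubmodule K.toSubalgebra →
      acl (gens P) ⊆ (K : Set F) := by
    intro P hP z hz
    have hgensK : gens P ⊆ (K : Set F) := by
      rintro y (hy | ⟨x, hx, rfl⟩)
      · exact hP hy
      · exact hKexp x (hP hx)
    have hz' : z ∈ acl ((K : Set F)) := acl_mono hgensK hz
    have hadj : Algebra.adjoin ℚ (K : Set F) = K.toSubalgebra := Algebra.adjoin_eq K.toSubalgebra
    rw [mem_acl_iff, hadj] at hz'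
    exact hKalg z hz'
  -- induction on the prefixes
  suffices key : ∀ k, k ≤ n →
      Λ ⊔ Submodule.span ℚ (u '' {j : Fin n | (j : ℕ) < k}) ≤ Subalgebra.toSubmodule K.toSubalgebra by
    have h := key n le_rfl
    rwa [image_lt_of_le u le_rfl] at h
  intro k hk
  induction k with
  | zero => rw [image_lt_zero, Submodule.span_empty, sup_bot_eq]; exact hΛK
  | succ k ih =>
    have hkn : k < n := hk
    rw [prefix_succ_eq Λ u hkn]
    refine sup_le (ih (Nat.le_of_succ_le hk)) ((Submodule.span_singleton_le_iff_mem _ _).2 ?_)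
    have hmem : u ⟨k, hkn⟩ ∈ (K : Set F) := haclK _ (ih (Nat.le_of_succ_le hk)) (hu ⟨k, hkn⟩)
    exact hmem

end CaseIIReduce

/-! ### Registered helper (crux stub list of stmt-Schanuel-0968) -/

/-- **Registered form of `CaseIIReduce.exists_chain_of_mem_sInf`** (all binders explicit): elements of
the ELA-core over `τ` lie in the span of an E/L/A-chain over `ℚτ`. [folklore] -/
theorem caseII_reduce_exists_chain_of_mem_sInf {F : Type} [Field F] [CharZero F] [ExponentialRing F]
    {τ a : F}
    (ha : a ∈ (sInf {K : IntermediateField ℚ F | τ ∈ K ∧ (∀ w ∈ K, exp w ∈ K) ∧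
      (∀ w : F, IsAlgebraic K w → w ∈ K) ∧ (∀ w : F, exp w ∈ K → w ∈ K)} :
        IntermediateField ℚ F)) :
    ∃ (n : ℕ) (u : Fin n → F),
      (∀ i : Fin n, u i ∈ acl (gens (Submodule.span ℚ {τ} ⊔ Submodule.span ℚ (u '' Set.Iio i))) ∨
        exp (u i) ∈ acl (gens (Submodule.span ℚ {τ} ⊔ Submodule.span ℚ (u '' Set.Iio i)))) ∧
      a ∈ Submodule.span ℚ {τ} ⊔ Submodule.span ℚ (range u) :=
  CaseIIReduce.exists_chain_of_mem_sInf ha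

end Summit.Schanuel.Schanuel.Theorems.RigidCore
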